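import Literature.Topology.FourManifolds.CappellShanesonThmBWindow
import Literature.Topology.FourManifolds.CappellShanesonClassGroupSeventyoneMain
import Literature.Topology.FourManifolds.CappellShanesonClassGroupSeventytwoMain
import Literature.Topology.FourManifolds.CappellShanesonClassGroupSeventyfourMain
import Literature.Topology.FourManifolds.CappellShanesonClassGroupSeventyeightMain
import HarnessLib

/-!
# Iwaki 2025, Theorem 5.1: Gompf's conjecture on `[-64, 69] ∪ {-73, -69, -67, -66, 71, 72, 74, 78}`, assembled

K. Iwaki, *Infinite families of standard Cappell–Shaneson homotopy 4-spheres*, Topology Appl. 366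
(2025) 109293 = arXiv:2404.05096, **Theorem 5.1**: "Conjecture (Gompf) is true for trace `n` if
`-64 ≤ n ≤ 69` or `n = -73, -69, -67, -66, 71, 72, 74, 78`" — where "Conjecture (Gompf) is true for
trace `n`" means (§1, following Kim–Yamada) that every Cappell–Shaneson matrix `A ∈ SL(3, ℤ)`
(`det (A - 1) = 1`) of trace `n` is Gompf equivalent to the Akbulut–Kirby matrix `A₀`: the tree's
`GompfConjectureForTrace n` (`CappellShanesonGompfEquivalence.lean`).

This file ASSEMBLES the theorem from the tree's pieces, all proved: the window `[-64, 69]`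
(Kim–Yamada's Theorem B, `forall_gompfConjectureForTrace_Icc_neg_sixtyfour_sixtynine`,
`CappellShanesonThmBWindow.lean` — 57 per-trace certified ideal-class computations), and the four
traces beyond it with their mirrors `5 - n` (`gompfConjectureForTrace_seventyone`, `…_seventytwo`,
`…_seventyfour`, `…_seventyeight`, `…_neg_sixtysix`, `…_neg_sixtyseven`, `…_neg_sixtynine`,
`…_neg_seventythree`: the certified class-group computations of
`CappellShanesonClassGroup{Seventyone,Seventytwo,Seventyfour,Seventyeight}{,Rel*,Cls,Main}.lean` —
Iwaki's Table of representatives (§4.3) reproduced exactly, class numbers `21, 23, 24, 24` —, Lemma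
5.2 (= Kim–Yamada's Lemma 6.1) into the window, the printed special chains of §5.1 certified in
`Iwaki2025/SpecialChains.lean`, and Kim–Yamada's Theorem A). With Gompf's three topological leaves
(the named facts `gompf2010_deltaMove`, `gompf2010_akbulutKirby_framings`, `akbulutKirby1979_sphere_four`
of `CappellShanesonGompfReduction.lean`) the corresponding Cappell–Shaneson homotopy 4-spheres are
standard (`nonempty_diffeomorph_sphere_four_of_iwaki2025`). The traces `70, 73, 75, 76, 77` of Iwaki's
Table are NOT claimed (the paper leaves special classes there undecided). No named fact is introduced
(D-0026); nothing topological is formalised beyond `GompfEquiv`.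

## References

* [Iwaki2025] K. Iwaki, Topology Appl. 366 (2025) 109293 (arXiv:2404.05096): Thm. 5.1 (§5.1), Lemma
  5.2, §4.3 (Table of representatives).
* [KimYamada2023] M. H. Kim, S. Yamada, Kyungpook Math. J. 63 (2023) 373–411 (arXiv:1707.03860):
  Thm. A, Thm. B, Cor. C and Remark 1.1.
-/

noncomputable section

open Set
open scoped Manifold ContDiff MatrixGroups

namespace Literature.Topology.FourManifolds

universe u

/-- **Iwaki 2025, Theorem 5.1** (matrix form, PROVED): Gompf's conjecture — every `A ∈ SL(3, ℤ)` with
`det (A - 1) = 1` and `tr A = n` is Gompf equivalent to `A₀` — holds for every trace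
`n ∈ [-64, 69] ∪ {-73, -69, -67, -66, 71, 72, 74, 78}`. [cite: Iwaki2025, Thm. 5.1] -/
theorem iwaki2025_gompfConjectureForTrace {n : ℤ}
    (hn : n ∈ Icc (-64 : ℤ) 69 ∨ n ∈ ({-73, -69, -67, -66, 71, 72, 74, 78} : Finset ℤ)) :
    GompfConjectureForTrace n := by
  rcases hn with hn | hn
  · exact gompfConjectureForTrace_of_mem_Icc_neg_sixtyfour_sixtynine hn
  · simp only [Finset.mem_insert, Finset.mem_singleton] at hn
    rcases hn with rfl | rfl | rfl | rfl | rfl | rfl | rfl | rfl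
    · exact gompfConjectureForTrace_neg_seventythree
    · exact gompfConjectureForTrace_neg_sixtynine
    · exact gompfConjectureForTrace_neg_sixtyseven
    · exact gompfConjectureForTrace_neg_sixtysix
    · exact gompfConjectureForTrace_seventyone
    · exact gompfConjectureForTrace_seventytwo
    · exact gompfConjectureForTrace_seventyfour
    · exact gompfConjectureForTrace_seventyeight

/-- **Iwaki 2025, Theorem 5.1**, as printed ("Conjecture is true for trace `n` if `-64 ≤ n ≤ 69` or
`n = -73, -69, -67, -66, 71, 72, 74, 78`"). [cite: Iwaki2025, Thm. 5.1] -/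
theorem iwaki2025_thm_5_1 (n : ℤ)
    (hn : (-64 ≤ n ∧ n ≤ 69) ∨ n = -73 ∨ n = -69 ∨ n = -67 ∨ n = -66 ∨ n = 71 ∨ n = 72 ∨ n = 74 ∨
      n = 78) :
    GompfConjectureForTrace n := by
  refine iwaki2025_gompfConjectureForTrace ?_
  rcases hn with ⟨h1, h2⟩ | h | h | h | h | h | h | h | h
  · exact Or.inl (mem_Icc.mpr ⟨h1, h2⟩)
  all_goals exact Or.inr (by subst h; decide)

/-- **The four traces beyond Kim–Yamada's window**: Gompf's conjecture holds for every trace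
`n ∈ [-64, 69] ∪ [71, 72] ∪ {74, 78}` and the mirrors — the window `[-64, 69]` extended by `71, 72`
on the right. [cite: Iwaki2025, Thm. 5.1] -/
theorem gompfConjectureForTrace_of_mem_Icc_neg_sixtyfour_seventytwo {n : ℤ} (hn : n ∈ Icc (-64 : ℤ) 72)
    (h70 : n ≠ 70) : GompfConjectureForTrace n := by
  simp only [mem_Icc] at hn
  obtain ⟨h1, h2⟩ := hn
  by_cases h69 : n ≤ 69
  · exact gompfConjectureForTrace_of_mem_Icc_neg_sixtyfour_sixtynine (mem_Icc.mpr ⟨h1, h69⟩)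
  · push Not at h69
    interval_cases n
    · exact absurd rfl h70
    · exact gompfConjectureForTrace_seventyone
    · exact gompfConjectureForTrace_seventytwo

section Spheres

variable (X : Type u) [TopologicalSpace X] [T2Space X] [SecondCountableTopology X]
  [ChartedSpace (EuclideanSpace ℝ (Fin 4)) X] [IsManifold (𝓡 4) ∞ X] [CompactSpace X]

/-- **Cappell–Shaneson homotopy 4-spheres of trace `n ∈ [-64, 69] ∪ {-73, -69, -67, -66, 71, 72, 74,
78}` are standard, granted Gompf's three topological leaves** — Iwaki's Theorem 5.1 combined with
Gompf's reduction (Kim–Yamada Remark 1.1 / Cor. C: "immediately follows"), the reduction resting on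
the named facts `gompf2010_deltaMove`, `gompf2010_akbulutKirby_framings`, `akbulutKirby1979_sphere_four`.
[cite: Iwaki2025, Thm. 5.1 and §1 (the standard CS spheres), with KimYamada2023, Remark 1.1] -/
theorem nonempty_diffeomorph_sphere_four_of_iwaki2025
    (hΔ : gompf2010_deltaMove.{u}) (h43 : gompf2010_akbulutKirby_framings.{0, 0})
    (hAK : akbulutKirby1979_sphere_four) {A : SL(3, ℤ)}
    (hdet : ((A : Matrix (Fin 3) (Fin 3) ℤ) - 1).det = 1)
    (htr : Matrix.trace (A : Matrix (Fin 3) (Fin 3) ℤ) ∈ Icc (-64 : ℤ) 69 ∨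
      Matrix.trace (A : Matrix (Fin 3) (Fin 3) ℤ) ∈ ({-73, -69, -67, -66, 71, 72, 74, 78} : Finset ℤ))
    (hX : IsCappellShanesonSphereOf A X) :
    Nonempty (X ≃ₘ⟮𝓡 4, 𝓡 4⟯ (Metric.sphere (0 : EuclideanSpace ℝ (Fin (4 + 1))) 1)) :=
  nonempty_diffeomorph_sphere_four_of_gompfConjectureForTrace X hΔ h43 hAK
    (iwaki2025_gompfConjectureForTrace htr) hdet rfl hX

end Spheres

end Literature.Topology.FourManifolds

end
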